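import Summits.HodgeConjecture.HodgeConjecture.Theorems.F0P6aDatumOfInputsDefsLetters   -- ★ previous part of the same Lines workfile `F0_P6a_DatumOfInputs` (Defs side; size-lint split ×4)
import HarnessLib

/-!
# `F0P6aDatumOfInputsDefsOrgans` — ★ RE-HOME of the DEFS SIDE of `Lines/F0_P6a_DatumOfInputs.lean` (ED. 3 a42642215a80d44d), PART 3 of 4 = §0e `namespace L1Fold` organs `stub_REF`, `stub_OLIFT`, `stub_PACK` (★-paid, sorry-free) and head `stub_LINES_of_organs` (ED. 3 ll. 485–748, `section Organs` with its own `variable` block).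

See PART 1 `Theorems/F0P6aDatumOfInputsDefsDock.lean` for the full re-home header and the hub՚s ED. 3 docstring (verbatim there).  Namespace and sections KEPT; code bytes =
the workfile՚s, docstrings included; options preamble repeated from PART 1.
HONEST LABEL: HC_CM is proved only modulo the 7 printed citations (2 remaining named inputs hLiu418 = stmt-HodgeConjecture-24832, h413 = stmt-HodgeConjecture-24833) until rung 0 closes; a re-home is count-neutral.
-/

set_option autoImplicit false

noncomputable section

namespace Summit.HodgeConjecture.HodgeConjecture.Cruxes.HLiu418.F0P6aDatumOfInputs

set_option linter.dupNamespace false  -- `Summit.HodgeConjecture.HodgeConjecture.…` BY DESIGN (D-0017)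

open CategoryTheory CategoryTheory.Limits NumberField IsDedekindDomain MulAction
open scoped Matrix Polynomial Pointwise MonoidalCategory
open Literature.NumberTheory.GaloisRepresentations
open Literature.NumberTheory.Automorphic Literature.NumberTheory.Automorphic.UnitaryGroup
open Literature.AlgebraicGeometry.ShimuraVarieties.UnitaryCanonicalModel
open Literature.NumberTheory.Automorphic.Liu2021.AppendixC
open Literature.AlgebraicGeometry.Motives (AlgPoints IntegralModel SchemeOver thickening thickeningGalAction thickeningLift specOver relFrobeniusOver frobeniusTwistOver)
open Literature.NumberTheory.DiophantineGeometry (geomResidueField specialFibreFunctor specResidueField)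
open Literature.AlgebraicGeometry.RelativeSpec (ActionOver)
open Literature.NumberTheory.EllipticCurves (genericFibre)
open Literature.AlgebraicGeometry.GroupSchemes.AffineGroupScheme (Alg quotIncl)
open Summit.HodgeConjecture.HodgeConjecture.Cruxes.HLiu418.F0P6cDictConstructors (kerFI AdmSub IdealIsEtale isAdm_kerFI)
open Summit.HodgeConjecture.HodgeConjecture.Cruxes.HLiu418.F0P6aModuliDatumDefs
open Summit.HodgeConjecture.HodgeConjecture.Cruxes.HLiu418.F0P6aRGDAssembly

/-! ### §0e THE L1 ORGANS AND HEAD, IN-LINE under the fresh namespace `L1Fold` (ED. 3 «L1 fold» v2ns: ex leaf `Lines/F0_P6a_StubLINES.lean` ED. 1 a2cea14b7c1cc2df ll. 58–316 VERBATIM; junction moved after the socket) -/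

namespace L1Fold

section Organs

variable {F : Type} [Field F] [NumberField F] [IsCMField F] [IsGalois ℚ F] {ι₁ : F →+* ℂ}
    {Jstar : Matrix (Fin 2) (Fin 2) F}
    {K₀ : C5.OpenCompactSubgroup ↥(finAdelic ↥(maximalRealSubfield F) F (IsCMField.complexConj F) 2 Jstar)}
    {S : RecordSystemGS F Jstar ι₁ K₀} {hU7ₛ : S.HeckeTranslateDefinedOver}
    {hJ : (Jstar.map (IsCMField.complexConj F))ᵀ = Jstar} {hJu : IsUnit Jstar}
    {Fi : Type} [Field Fi] [Algebra F Fi] [FiniteDimensional F Fi] [IsGalois F Fi] {Kc : C5.SmallLevel K₀} {G : Type} [Group G] [Finite G]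
    {𝓜 : IntegralModel (𝓞 F) F ((thickening F Fi).obj (S.M.obj Kc))}
    {w : HeightOneSpectrum (𝓞 F)} {hw : (IsCMField.complexConj F) • w ≠ w} {h𝓨 : (𝓜.localise w).IsSmoothProper 1}
    {θ : ActionOver (𝓜.localise w).total.hom ((Fi ≃ₐ[F] Fi) × G)}
    {e : Fi →ₐ[F] AlgebraicClosure (w.adicCompletion F)}

/-! ### §1 THE ORGANS (registered stub `stub_PACK` carries the only `sorry`; `stub_REF` closed in-line at v2, `stub_OLIFT` at v3) -/

set_option maxHeartbeats 400000 in
/-- **`stub_REF` (S) — A REFERENCE PRESENTATION** (v2: CLOSED in-line by ★ p847697 `exists_normal_referencePresentation K t₁ t₂`, LA1-p02 (g0)): for a small level `K` and two group elements `t₁ t₂` there is a level `N₀ ≤ K` NORMALISED by `K`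
(`k⁻¹ N₀ k ⊆ N₀`, `k ∈ K`) together with systems of representatives `rd₁` of `K·t₁K ⁄ K` and `rd₂` of `K·t₂K ⁄ K` admissible at `N₀` (`(rdᵢ β)⁻¹ N₀ (rdᵢ β) ⊆ K`).
Why plausibly true: the two orbits are finite (★ `finite_orbit_quotient` under ★ `isHeckeTriple_top_of_isCompact_isOpen K.1.1 K.1.2.2 K.1.2.1`), `rdᵢ := Quotient.out ∘ (·.1)`,
and ★ `C5.SmallLevel.exists_normal_le_forall_heckeLE (image rd₁ ∪ image rd₂) K` gives `N₀` with BOTH conjuncts.  Pure group side (no record).  Paid: ★ `AppendixC/RecordHeckeReferencePresentation.lean` p847697.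
[cite: Milne2005ShimuraVarieties, §13 p. 118 L21–26] [cite: Liu2021, §4.2 l. 2060–2074] -/
theorem stub_REF (K : C5.SmallLevel K₀) (t₁ t₂ : ↥(finAdelic ↥(maximalRealSubfield F) F (IsCMField.complexConj F) 2 Jstar)) :
    ∃ (N₀ : C5.SmallLevel K₀) (_ : N₀ ≤ K), (∀ k ∈ K.1.1, C5.HeckeLE k N₀ N₀) ∧
      (∃ rd₁ : orbit (K.1.1 : Subgroup ↥(finAdelic ↥(maximalRealSubfield F) F (IsCMField.complexConj F) 2 Jstar))
           ((t₁ : ↥(finAdelic ↥(maximalRealSubfield F) F (IsCMField.complexConj F) 2 Jstar)) :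
             ↥(finAdelic ↥(maximalRealSubfield F) F (IsCMField.complexConj F) 2 Jstar) ⧸
               (K.1.1 : Subgroup ↥(finAdelic ↥(maximalRealSubfield F) F (IsCMField.complexConj F) 2 Jstar))) →
         ↥(finAdelic ↥(maximalRealSubfield F) F (IsCMField.complexConj F) 2 Jstar),
        (∀ β, ((rd₁ β : ↥(finAdelic ↥(maximalRealSubfield F) F (IsCMField.complexConj F) 2 Jstar)) :
            ↥(finAdelic ↥(maximalRealSubfield F) F (IsCMField.complexConj F) 2 Jstar) ⧸
              (K.1.1 : Subgroup ↥(finAdelic ↥(maximalRealSubfield F) F (IsCMField.complexConj F) 2 Jstar))) = β.1) ∧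
        ∀ β, C5.HeckeLE (rd₁ β) N₀ K) ∧
      ∃ rd₂ : orbit (K.1.1 : Subgroup ↥(finAdelic ↥(maximalRealSubfield F) F (IsCMField.complexConj F) 2 Jstar))
           ((t₂ : ↥(finAdelic ↥(maximalRealSubfield F) F (IsCMField.complexConj F) 2 Jstar)) :
             ↥(finAdelic ↥(maximalRealSubfield F) F (IsCMField.complexConj F) 2 Jstar) ⧸
               (K.1.1 : Subgroup ↥(finAdelic ↥(maximalRealSubfield F) F (IsCMField.complexConj F) 2 Jstar))) →
         ↥(finAdelic ↥(maximalRealSubfield F) F (IsCMField.complexConj F) 2 Jstar),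
        (∀ β, ((rd₂ β : ↥(finAdelic ↥(maximalRealSubfield F) F (IsCMField.complexConj F) 2 Jstar)) :
            ↥(finAdelic ↥(maximalRealSubfield F) F (IsCMField.complexConj F) 2 Jstar) ⧸
              (K.1.1 : Subgroup ↥(finAdelic ↥(maximalRealSubfield F) F (IsCMField.complexConj F) 2 Jstar))) = β.1) ∧
        ∀ β, C5.HeckeLE (rd₂ β) N₀ K :=
  exists_normal_referencePresentation K t₁ t₂

set_option maxHeartbeats 400000 in
/-- **`stub_OLIFT` (M) — HECKE AT EVERY PRESENTATION FROM HECKE AT CHOSEN LIFTS** (v3: CLOSED in-line by ★ p847810 `RecordSystemGS.hecke_of_hecke_at_chosen_lifts`, LA1-p01 (g0),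
with `T := recordHeckeTranslateGS S hU7ₛ · · K ·`, `hT := isHeckeTranslate_recordHeckeTranslateGS …`, `hLQ := RecordSystemGS.isLevelQuotient_of_heckeTranslateDefinedOver S hU7ₛ`) (★ `hecke_of_hecke_at_level` with `h₀` weakened: the clause is asked, for every
`y ∈ M⋆_K(Ω)`, at ONE lift `x₀ ∈ M⋆_{N₀}(Ω)` of `y` only; price: `N₀` normalised by `K`, binder `hn₀`).  Why plausibly true: given a presentation `(N′, rc₁, rc₂, x′)`
over `y′`, ★՚s common normal level `N″ ≤ N′ ⊓ N₀` and lift `x″` give `x₀″ := u x″ ∈ M⋆_{N₀}(Ω)` over `y′` with `T_{rc β} x′ = T_{rd β} x₀″` (★ §1); the chosen lift `x₀`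
of `y′` and `x₀″` differ by a translate, `T_k x₀ = x₀″` for some `k ∈ K` (`M⋆_{N₀} → M⋆_K` is the quotient by `K ⁄ N₀`: ★ `isLevelQuotient_of_heckeTranslateDefinedOver` +
★ `IsSepQuotient.exists_map_act_eq_of_map_eq_geometric_of_finiteIndex`), and `T_{rd β} (T_k x₀) = T_{rd (k • β)} x₀` (three ★ lines), so `e′ := (k • ·).trans e`;
the `t₂`-conjunct rides along with the same `k`.  Record side only, generic `t₁ t₂ Line quotΩ translΩ Ω`.  Paid: ★ `ShimuraVarieties/UnitaryShimuraCurveHeckePresentationLift.lean` p847810.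
[cite: Milne2005ShimuraVarieties, §5 p. 57, Rem. 5.29 (c) p. 65, Thm. 13.6 p. 118] [cite: Deligne1979ShimuraVarieties, 2.7.1 (c)] [cite: Liu2021, Prop. D.8 (1) p. 135] -/
theorem stub_OLIFT {Ω : Type} [Field Ω] [Algebra F Ω] [IsAlgClosed Ω]
    (K : C5.SmallLevel K₀) (t₁ t₂ : ↥(finAdelic ↥(maximalRealSubfield F) F (IsCMField.complexConj F) 2 Jstar))
    {Line : AlgPoints (S.M.obj K) Ω → Type}
    (quotΩ : ∀ y, Line y → AlgPoints (S.M.obj K) Ω) (translΩ : AlgPoints (S.M.obj K) Ω → AlgPoints (S.M.obj K) Ω)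
    (N₀ : C5.SmallLevel K₀) (hN₀K : N₀ ≤ K) (hn₀ : ∀ k ∈ K.1.1, C5.HeckeLE k N₀ N₀)
    (rd₁ : orbit (K.1.1 : Subgroup ↥(finAdelic ↥(maximalRealSubfield F) F (IsCMField.complexConj F) 2 Jstar))
         ((t₁ : ↥(finAdelic ↥(maximalRealSubfield F) F (IsCMField.complexConj F) 2 Jstar)) :
           ↥(finAdelic ↥(maximalRealSubfield F) F (IsCMField.complexConj F) 2 Jstar) ⧸
             (K.1.1 : Subgroup ↥(finAdelic ↥(maximalRealSubfield F) F (IsCMField.complexConj F) 2 Jstar))) →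
       ↥(finAdelic ↥(maximalRealSubfield F) F (IsCMField.complexConj F) 2 Jstar))
    (hrd₁ : ∀ β, ((rd₁ β : ↥(finAdelic ↥(maximalRealSubfield F) F (IsCMField.complexConj F) 2 Jstar)) :
        ↥(finAdelic ↥(maximalRealSubfield F) F (IsCMField.complexConj F) 2 Jstar) ⧸
          (K.1.1 : Subgroup ↥(finAdelic ↥(maximalRealSubfield F) F (IsCMField.complexConj F) 2 Jstar))) = β.1)
    (hrdN₁ : ∀ β, C5.HeckeLE (rd₁ β) N₀ K)
    (rd₂ : orbit (K.1.1 : Subgroup ↥(finAdelic ↥(maximalRealSubfield F) F (IsCMField.complexConj F) 2 Jstar))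
         ((t₂ : ↥(finAdelic ↥(maximalRealSubfield F) F (IsCMField.complexConj F) 2 Jstar)) :
           ↥(finAdelic ↥(maximalRealSubfield F) F (IsCMField.complexConj F) 2 Jstar) ⧸
             (K.1.1 : Subgroup ↥(finAdelic ↥(maximalRealSubfield F) F (IsCMField.complexConj F) 2 Jstar))) →
       ↥(finAdelic ↥(maximalRealSubfield F) F (IsCMField.complexConj F) 2 Jstar))
    (hrd₂ : ∀ β, ((rd₂ β : ↥(finAdelic ↥(maximalRealSubfield F) F (IsCMField.complexConj F) 2 Jstar)) :
        ↥(finAdelic ↥(maximalRealSubfield F) F (IsCMField.complexConj F) 2 Jstar) ⧸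
          (K.1.1 : Subgroup ↥(finAdelic ↥(maximalRealSubfield F) F (IsCMField.complexConj F) 2 Jstar))) = β.1)
    (hrdN₂ : ∀ β, C5.HeckeLE (rd₂ β) N₀ K)
    (h₀ : ∀ y : AlgPoints (S.M.obj K) Ω, ∃ x₀ : AlgPoints (S.M.obj N₀) Ω, AlgPoints.map (S.M.map (homOfLE hN₀K)) x₀ = y ∧
      ∃ e : (orbit (K.1.1 : Subgroup ↥(finAdelic ↥(maximalRealSubfield F) F (IsCMField.complexConj F) 2 Jstar))
         ((t₁ : ↥(finAdelic ↥(maximalRealSubfield F) F (IsCMField.complexConj F) 2 Jstar)) :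
           ↥(finAdelic ↥(maximalRealSubfield F) F (IsCMField.complexConj F) 2 Jstar) ⧸
             (K.1.1 : Subgroup ↥(finAdelic ↥(maximalRealSubfield F) F (IsCMField.complexConj F) 2 Jstar)))) ≃ Line y,
        (∀ β, AlgPoints.map (recordHeckeTranslateGS S hU7ₛ (rd₁ β) N₀ K (hrdN₁ β)) x₀ = quotΩ y (e β)) ∧
        ∀ β₂, AlgPoints.map (recordHeckeTranslateGS S hU7ₛ (rd₂ β₂) N₀ K (hrdN₂ β₂)) x₀ = translΩ y)
    (N' : C5.SmallLevel K₀) (hN'K : N' ≤ K)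
    (rc₁ : orbit (K.1.1 : Subgroup ↥(finAdelic ↥(maximalRealSubfield F) F (IsCMField.complexConj F) 2 Jstar))
         ((t₁ : ↥(finAdelic ↥(maximalRealSubfield F) F (IsCMField.complexConj F) 2 Jstar)) :
           ↥(finAdelic ↥(maximalRealSubfield F) F (IsCMField.complexConj F) 2 Jstar) ⧸
             (K.1.1 : Subgroup ↥(finAdelic ↥(maximalRealSubfield F) F (IsCMField.complexConj F) 2 Jstar))) →
       ↥(finAdelic ↥(maximalRealSubfield F) F (IsCMField.complexConj F) 2 Jstar))
    (hrc₁ : ∀ β, ((rc₁ β : ↥(finAdelic ↥(maximalRealSubfield F) F (IsCMField.complexConj F) 2 Jstar)) :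
        ↥(finAdelic ↥(maximalRealSubfield F) F (IsCMField.complexConj F) 2 Jstar) ⧸
          (K.1.1 : Subgroup ↥(finAdelic ↥(maximalRealSubfield F) F (IsCMField.complexConj F) 2 Jstar))) = β.1)
    (hrcN₁ : ∀ β, C5.HeckeLE (rc₁ β) N' K)
    (rc₂ : orbit (K.1.1 : Subgroup ↥(finAdelic ↥(maximalRealSubfield F) F (IsCMField.complexConj F) 2 Jstar))
         ((t₂ : ↥(finAdelic ↥(maximalRealSubfield F) F (IsCMField.complexConj F) 2 Jstar)) :
           ↥(finAdelic ↥(maximalRealSubfield F) F (IsCMField.complexConj F) 2 Jstar) ⧸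
             (K.1.1 : Subgroup ↥(finAdelic ↥(maximalRealSubfield F) F (IsCMField.complexConj F) 2 Jstar))) →
       ↥(finAdelic ↥(maximalRealSubfield F) F (IsCMField.complexConj F) 2 Jstar))
    (hrc₂ : ∀ β, ((rc₂ β : ↥(finAdelic ↥(maximalRealSubfield F) F (IsCMField.complexConj F) 2 Jstar)) :
        ↥(finAdelic ↥(maximalRealSubfield F) F (IsCMField.complexConj F) 2 Jstar) ⧸
          (K.1.1 : Subgroup ↥(finAdelic ↥(maximalRealSubfield F) F (IsCMField.complexConj F) 2 Jstar))) = β.1)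
    (hrcN₂ : ∀ β, C5.HeckeLE (rc₂ β) N' K)
    (x' : AlgPoints (S.M.obj N') Ω) :
    ∃ e : (orbit (K.1.1 : Subgroup ↥(finAdelic ↥(maximalRealSubfield F) F (IsCMField.complexConj F) 2 Jstar))
         ((t₁ : ↥(finAdelic ↥(maximalRealSubfield F) F (IsCMField.complexConj F) 2 Jstar)) :
           ↥(finAdelic ↥(maximalRealSubfield F) F (IsCMField.complexConj F) 2 Jstar) ⧸
             (K.1.1 : Subgroup ↥(finAdelic ↥(maximalRealSubfield F) F (IsCMField.complexConj F) 2 Jstar)))) ≃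
          Line (AlgPoints.map (S.M.map (homOfLE hN'K)) x'),
      (∀ β, AlgPoints.map (recordHeckeTranslateGS S hU7ₛ (rc₁ β) N' K (hrcN₁ β)) x' =
          quotΩ (AlgPoints.map (S.M.map (homOfLE hN'K)) x') (e β)) ∧
      ∀ β₂, AlgPoints.map (recordHeckeTranslateGS S hU7ₛ (rc₂ β₂) N' K (hrcN₂ β₂)) x' =
          translΩ (AlgPoints.map (S.M.map (homOfLE hN'K)) x') :=
  RecordSystemGS.hecke_of_hecke_at_chosen_lifts S (RecordSystemGS.isLevelQuotient_of_heckeTranslateDefinedOver S hU7ₛ) K t₁ t₂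
    (fun r M h => recordHeckeTranslateGS S hU7ₛ r M K h) (fun r M h => isHeckeTranslate_recordHeckeTranslateGS S hU7ₛ r M K h)
    quotΩ translΩ N₀ hN₀K hn₀ rd₁ hrd₁ hrdN₁ rd₂ hrd₂ hrdN₂ h₀ N' hN'K rc₁ hrc₁ hrcN₁ rc₂ hrc₂ hrcN₂ x'

omit [FiniteDimensional F Fi] [IsGalois F Fi] [Finite G] in
set_option maxHeartbeats 400000 in
/-- **`stub_PACK` (M) — THE (L4) ROOFS PACKAGED PER POINT at a reference presentation `(N₀, rd₁, rd₂)` (with `N₀` normalised by `Kc`)**: for every `y ∈ M⋆_{Kc}(Ω)` a lift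
`x₀ ∈ M⋆_{N₀}(Ω)`, a bijection `e_y : Kc·t₁Kc ⁄ Kc ≃ LineOf I y`, readings `q : LineOf I y → M⋆_{Kc}(Ω)` and `t ∈ M⋆_{Kc}(Ω)` such that `T_{rd₁ β} x₀ = q (e_y β)`,
`T_{rd₂ β₂} x₀ = t` for every `β₂`, every `q L` is a roof neighbour of `y` through a kernel meeting the `𝔭_{c•w}`-torsion in `L` (body of `RoofLink` verbatim), and `t` is the
roof neighbour through the whole `𝔭_{c•w}`-torsion (body of `RoofLink₂` verbatim).  Why plausibly true: lift `y` (★ `exists_algPoints_map_eq_of_normal`,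
`hLQ := isLevelQuotient_of_heckeTranslateDefinedOver S hU7ₛ`), `subst`, read (L4) `I.heckeRoofΩ e N₀ hN₀Kc rd₁ hrd₁ hrdN₁ rd₂ hrd₂ hrdN₂ x₀` → `Hβ inj adm surj roof roof₂`,
`e_y := Equiv.ofBijective (fun β => ⟨Hβ β, adm β⟩) ⟨…, …⟩` ((L4b)՚s admissibility clause IS the predicate of `LineOf` :206), `q L := T_{rd₁ (e_y.symm L)} x₀`,
`t := T_{rd₂ β₂⁰} x₀` with `β₂⁰ := ⟨_, mem_orbit_self _⟩` and «∀ β₂» by ★ `coe_eq_of_mem_orbit_heckeElementAt_self` (the `t₂`-orbit is a singleton, `t₂ = ⟨ϖ⟩` central) +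
★ `map_recordHeckeTranslateGS_eq_of_coset_eq` (at `N″ = N′ = N₀`); the roof clauses are (L4c) at `β := e_y.symm L` and (L4d) at `β₂⁰`.  LINES currency (D-line vocabulary);
payer LA1-p03 (by-import proof file over the served D-line olean, folded into the leaf edition). [cite: Liu2021, Prop. D.8 (1)(2) p. 135]
[cite: HarrisTaylorAMS2001, §III.4, pp. 108–110] -/
theorem stub_PACK (I : RGDInputsAt F ι₁ Jstar K₀ S hU7ₛ hJ hJu Fi Kc G 𝓜 w hw h𝓨 θ e)
    (N₀ : C5.SmallLevel K₀) (hN₀Kc : N₀ ≤ Kc) (_hn₀ : ∀ k ∈ Kc.1.1, C5.HeckeLE k N₀ N₀)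
    (rd₁ : orbit (Kc.1.1 : Subgroup ↥(finAdelic ↥(maximalRealSubfield F) F (IsCMField.complexConj F) 2 Jstar))
         ((UnitaryGroup.heckeElementAt ↥(maximalRealSubfield F) F (IsCMField.complexConj F) 2 Jstar
             (⟨w, rfl⟩ : UnitaryGroup.PlacesOver F (w.under (𝓞 ↥(maximalRealSubfield F))))
             (IsCMField.complexConj_ne_one F) hJ hw (UnitaryGroup.isUnit_placeForm Jstar hJu w) (HeckeCharacter.uniformizer F w) 1 :
           ↥(finAdelic ↥(maximalRealSubfield F) F (IsCMField.complexConj F) 2 Jstar)) :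
           ↥(finAdelic ↥(maximalRealSubfield F) F (IsCMField.complexConj F) 2 Jstar) ⧸
             (Kc.1.1 : Subgroup ↥(finAdelic ↥(maximalRealSubfield F) F (IsCMField.complexConj F) 2 Jstar))) →
       ↥(finAdelic ↥(maximalRealSubfield F) F (IsCMField.complexConj F) 2 Jstar))
    (_hrd₁ : ∀ β, ((rd₁ β : ↥(finAdelic ↥(maximalRealSubfield F) F (IsCMField.complexConj F) 2 Jstar)) :
        ↥(finAdelic ↥(maximalRealSubfield F) F (IsCMField.complexConj F) 2 Jstar) ⧸
          (Kc.1.1 : Subgroup ↥(finAdelic ↥(maximalRealSubfield F) F (IsCMField.complexConj F) 2 Jstar))) = β.1)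
    (hrdN₁ : ∀ β, C5.HeckeLE (rd₁ β) N₀ Kc)
    (rd₂ : orbit (Kc.1.1 : Subgroup ↥(finAdelic ↥(maximalRealSubfield F) F (IsCMField.complexConj F) 2 Jstar))
         ((UnitaryGroup.heckeElementAt ↥(maximalRealSubfield F) F (IsCMField.complexConj F) 2 Jstar
             (⟨w, rfl⟩ : UnitaryGroup.PlacesOver F (w.under (𝓞 ↥(maximalRealSubfield F))))
             (IsCMField.complexConj_ne_one F) hJ hw (UnitaryGroup.isUnit_placeForm Jstar hJu w) (HeckeCharacter.uniformizer F w) 2 :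
           ↥(finAdelic ↥(maximalRealSubfield F) F (IsCMField.complexConj F) 2 Jstar)) :
           ↥(finAdelic ↥(maximalRealSubfield F) F (IsCMField.complexConj F) 2 Jstar) ⧸
             (Kc.1.1 : Subgroup ↥(finAdelic ↥(maximalRealSubfield F) F (IsCMField.complexConj F) 2 Jstar))) →
       ↥(finAdelic ↥(maximalRealSubfield F) F (IsCMField.complexConj F) 2 Jstar))
    (_hrd₂ : ∀ β, ((rd₂ β : ↥(finAdelic ↥(maximalRealSubfield F) F (IsCMField.complexConj F) 2 Jstar)) :
        ↥(finAdelic ↥(maximalRealSubfield F) F (IsCMField.complexConj F) 2 Jstar) ⧸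
          (Kc.1.1 : Subgroup ↥(finAdelic ↥(maximalRealSubfield F) F (IsCMField.complexConj F) 2 Jstar))) = β.1)
    (hrdN₂ : ∀ β, C5.HeckeLE (rd₂ β) N₀ Kc)
    (y : AlgPoints (S.M.obj Kc) (AlgebraicClosure (w.adicCompletion F))) :
    ∃ (x₀ : AlgPoints (S.M.obj N₀) (AlgebraicClosure (w.adicCompletion F)))
      (ey : (orbit (Kc.1.1 : Subgroup ↥(finAdelic ↥(maximalRealSubfield F) F (IsCMField.complexConj F) 2 Jstar))
         ((UnitaryGroup.heckeElementAt ↥(maximalRealSubfield F) F (IsCMField.complexConj F) 2 Jstar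
             (⟨w, rfl⟩ : UnitaryGroup.PlacesOver F (w.under (𝓞 ↥(maximalRealSubfield F))))
             (IsCMField.complexConj_ne_one F) hJ hw (UnitaryGroup.isUnit_placeForm Jstar hJu w) (HeckeCharacter.uniformizer F w) 1 :
           ↥(finAdelic ↥(maximalRealSubfield F) F (IsCMField.complexConj F) 2 Jstar)) :
           ↥(finAdelic ↥(maximalRealSubfield F) F (IsCMField.complexConj F) 2 Jstar) ⧸
             (Kc.1.1 : Subgroup ↥(finAdelic ↥(maximalRealSubfield F) F (IsCMField.complexConj F) 2 Jstar)))) ≃ LineOf I y)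
      (q : LineOf I y → AlgPoints (S.M.obj Kc) (AlgebraicClosure (w.adicCompletion F)))
      (t : AlgPoints (S.M.obj Kc) (AlgebraicClosure (w.adicCompletion F))),
      AlgPoints.map (S.M.map (homOfLE hN₀Kc)) x₀ = y ∧
      (∀ β, AlgPoints.map (recordHeckeTranslateGS S hU7ₛ (rd₁ β) N₀ Kc (hrdN₁ β)) x₀ = q (ey β)) ∧
      (∀ β₂, AlgPoints.map (recordHeckeTranslateGS S hU7ₛ (rd₂ β₂) N₀ Kc (hrdN₂ β₂)) x₀ = t) ∧
      (∀ L : LineOf I y, ∃ K : Subgroup ((fibreΩOf S Kc 𝓜 w e I.univ y).Points (AlgebraicClosure (w.adicCompletion F))),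
        (∀ P, P ∈ L.1 ↔ P ∈ K ∧ IsIdealTorsionΩ S Kc 𝓜 w e I.univ I.act y ((IsCMField.complexConj F) • w).asIdeal P) ∧
        RoofΩ S Kc 𝓜 w e I.univ I.act I.dual I.pol I.lvl I.pChar w.asIdeal y (q L) K) ∧
      ∃ K₂ : Subgroup ((fibreΩOf S Kc 𝓜 w e I.univ y).Points (AlgebraicClosure (w.adicCompletion F))),
        (∀ P, P ∈ K₂ ↔ IsIdealTorsionΩ S Kc 𝓜 w e I.univ I.act y ((IsCMField.complexConj F) • w).asIdeal P) ∧
        RoofΩ S Kc 𝓜 w e I.univ I.act I.dual I.pol I.lvl I.pChar w.asIdeal y t K₂ := by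
  classical
  have hLQ : S.IsLevelQuotient := RecordSystemGS.isLevelQuotient_of_heckeTranslateDefinedOver S hU7ₛ
  -- lift `y` to the reference level and work over `y := u x₀` (`Exists.elim`, not `obtain`: `rcases` times out at `whnf` here)
  refine (RecordSystemGS.exists_algPoints_map_eq_of_isLevelQuotient S hLQ hN₀Kc y).elim fun x₀ hx₀ => ?_
  subst hx₀
  -- (L4) at the reference presentation on the sheet `e`
  refine (I.heckeRoofΩ e N₀ hN₀Kc rd₁ _hrd₁ hrdN₁ rd₂ _hrd₂ hrdN₂ x₀).elim fun Hβ hH => ?_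
  have hinj := hH.1
  have hadm := hH.2.1
  have hsurj := hH.2.2.1
  have hroof := hH.2.2.2.1
  have hroof₂ := hH.2.2.2.2
  -- the line bijection `β ↦ ⟨H_β, adm β⟩`
  let f : (orbit (Kc.1.1 : Subgroup ↥(finAdelic ↥(maximalRealSubfield F) F (IsCMField.complexConj F) 2 Jstar))
         ((UnitaryGroup.heckeElementAt ↥(maximalRealSubfield F) F (IsCMField.complexConj F) 2 Jstar
             (⟨w, rfl⟩ : UnitaryGroup.PlacesOver F (w.under (𝓞 ↥(maximalRealSubfield F))))
             (IsCMField.complexConj_ne_one F) hJ hw (UnitaryGroup.isUnit_placeForm Jstar hJu w) (HeckeCharacter.uniformizer F w) 1 :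
           ↥(finAdelic ↥(maximalRealSubfield F) F (IsCMField.complexConj F) 2 Jstar)) :
           ↥(finAdelic ↥(maximalRealSubfield F) F (IsCMField.complexConj F) 2 Jstar) ⧸
             (Kc.1.1 : Subgroup ↥(finAdelic ↥(maximalRealSubfield F) F (IsCMField.complexConj F) 2 Jstar)))) →
      LineOf I (AlgPoints.map (S.M.map (homOfLE hN₀Kc)) x₀) :=
    fun β => ⟨Hβ β, hadm β⟩
  have hf : Function.Bijective f := by
    refine ⟨fun β β' h => hinj (congrArg Subtype.val h), fun L => ?_⟩
    refine (hsurj L.1 L.2.1 L.2.2.1 L.2.2.2).elim fun β hβ => ?_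
    exact ⟨β, Subtype.ext hβ⟩
  let ey := Equiv.ofBijective f hf
  -- the singleton `t₂`-index
  let β₂₀ : orbit (Kc.1.1 : Subgroup ↥(finAdelic ↥(maximalRealSubfield F) F (IsCMField.complexConj F) 2 Jstar))
         ((UnitaryGroup.heckeElementAt ↥(maximalRealSubfield F) F (IsCMField.complexConj F) 2 Jstar
             (⟨w, rfl⟩ : UnitaryGroup.PlacesOver F (w.under (𝓞 ↥(maximalRealSubfield F))))
             (IsCMField.complexConj_ne_one F) hJ hw (UnitaryGroup.isUnit_placeForm Jstar hJu w) (HeckeCharacter.uniformizer F w) 2 :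
           ↥(finAdelic ↥(maximalRealSubfield F) F (IsCMField.complexConj F) 2 Jstar)) :
           ↥(finAdelic ↥(maximalRealSubfield F) F (IsCMField.complexConj F) 2 Jstar) ⧸
             (Kc.1.1 : Subgroup ↥(finAdelic ↥(maximalRealSubfield F) F (IsCMField.complexConj F) 2 Jstar))) :=
    ⟨_, mem_orbit_self _⟩
  have hβ₂ : ∀ β₂, β₂ = β₂₀ := fun β₂ => Subtype.ext
    ((UnitaryGroup.coe_eq_of_mem_orbit_heckeElementAt_self _ _ _ _ _ _ _ β₂).trans
      (UnitaryGroup.coe_eq_of_mem_orbit_heckeElementAt_self _ _ _ _ _ _ _ β₂₀).symm)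
  refine ⟨x₀, ey, fun L => AlgPoints.map (recordHeckeTranslateGS S hU7ₛ (rd₁ (ey.symm L)) N₀ Kc (hrdN₁ (ey.symm L))) x₀,
    AlgPoints.map (recordHeckeTranslateGS S hU7ₛ (rd₂ β₂₀) N₀ Kc (hrdN₂ β₂₀)) x₀, rfl, fun β => ?_, fun β₂ => ?_, fun L => ?_, ?_⟩
  · -- `T_{rd₁ β} x₀ = q (ey β)` (`ey.symm (ey β) = β` under the dependent proof argument)
    exact congrArg (fun z => AlgPoints.map (recordHeckeTranslateGS S hU7ₛ (rd₁ z) N₀ Kc (hrdN₁ z)) x₀)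
      (ey.symm_apply_apply β).symm
  · -- `T_{rd₂ β₂} x₀ = t`
    rw [hβ₂ β₂]
  · -- the roof of `q L` through a kernel meeting the `𝔭_{c•w}`-torsion in `L`
    refine (hroof (ey.symm L)).elim fun K hKR => ?_
    have hL : Hβ (ey.symm L) = L.1 := congrArg Subtype.val (ey.apply_symm_apply L)
    refine ⟨K, fun P => ?_, hKR.2⟩
    rw [← hL]
    exact hKR.1 P
  · -- the roof of `t` through the whole `𝔭_{c•w}`-torsion
    exact hroof₂ β₂₀

/-! ### §2 THE HEAD `stub_LINES_of_organs` = the type of the socket `stub_LINES`, TOKEN FOR TOKEN, sorry-free over the organs -/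

set_option linter.unusedSectionVars false in  -- the head KEEPS the socket՚s frame instances `[FiniteDimensional F Fi] [IsGalois F Fi] [Finite G]` (token-for-token junction) although the proof does not use them
set_option maxHeartbeats 400000 in
/-- **HEAD `stub_LINES_of_organs`** — the D-line socket `stub_LINES` (:498) TOKEN FOR TOKEN, from `stub_REF` + `stub_PACK` + `stub_OLIFT`: take the reference presentation
`(N₀, rd₁, rd₂)`; for every `y` the package gives `x₀(y)`, `e_y`, `q_y`, `t_y`; put `quotΩ y := q_y`, `translΩ y := t_y`; `RoofLink`∕`RoofLink₂` are the package՚s roof clauses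
verbatim and `HeckeClause` (every presentation `(N′, rc₁, rc₂, x′)`) is `stub_OLIFT` at `Line := LineOf I` fed with the package՚s Hecke clauses at the chosen lifts.
Sorry-free; `--axioms` = TRIO ∪ {sorryAx via the three organs only}. [cite: Liu2021, Prop. D.8 (1)(2) p. 135] [cite: HarrisTaylorAMS2001, §III.4, pp. 108–110] -/
theorem stub_LINES_of_organs (I : RGDInputsAt F ι₁ Jstar K₀ S hU7ₛ hJ hJu Fi Kc G 𝓜 w hw h𝓨 θ e) :
    ∃ (quotΩ : ∀ y, LineOf I y → AlgPoints (S.M.obj Kc) (AlgebraicClosure (w.adicCompletion F)))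
      (translΩ : AlgPoints (S.M.obj Kc) (AlgebraicClosure (w.adicCompletion F)) → AlgPoints (S.M.obj Kc) (AlgebraicClosure (w.adicCompletion F))),
      HeckeClause I quotΩ translΩ ∧ RoofLink I quotΩ ∧ RoofLink₂ I translΩ := by
  -- the reference presentation
  obtain ⟨N₀, hN₀Kc, hn₀, ⟨rd₁, hrd₁, hrdN₁⟩, ⟨rd₂, hrd₂, hrdN₂⟩⟩ := stub_REF Kc
    (UnitaryGroup.heckeElementAt ↥(maximalRealSubfield F) F (IsCMField.complexConj F) 2 Jstar
      (⟨w, rfl⟩ : UnitaryGroup.PlacesOver F (w.under (𝓞 ↥(maximalRealSubfield F))))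
      (IsCMField.complexConj_ne_one F) hJ hw (UnitaryGroup.isUnit_placeForm Jstar hJu w) (HeckeCharacter.uniformizer F w) 1)
    (UnitaryGroup.heckeElementAt ↥(maximalRealSubfield F) F (IsCMField.complexConj F) 2 Jstar
      (⟨w, rfl⟩ : UnitaryGroup.PlacesOver F (w.under (𝓞 ↥(maximalRealSubfield F))))
      (IsCMField.complexConj_ne_one F) hJ hw (UnitaryGroup.isUnit_placeForm Jstar hJu w) (HeckeCharacter.uniformizer F w) 2)
  -- the per-point package at the reference presentation
  have P := stub_PACK I N₀ hN₀Kc hn₀ rd₁ hrd₁ hrdN₁ rd₂ hrd₂ hrdN₂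
  choose x₀ ey q t hx₀ hq ht hroof hroof₂ using P
  refine ⟨q, t, ?_, fun y L => hroof y L, fun y => hroof₂ y⟩
  -- the Hecke clause at every presentation
  intro N' hN'Kc rc₁ hrc₁ hrcN₁ rc₂ hrc₂ hrcN₂ x'
  exact stub_OLIFT (hU7ₛ := hU7ₛ) Kc _ _ (Line := LineOf I) q t N₀ hN₀Kc hn₀ rd₁ hrd₁ hrdN₁ rd₂ hrd₂ hrdN₂
    (fun y => ⟨x₀ y, hx₀ y, ey y, hq y, ht y⟩) N' hN'Kc rc₁ hrc₁ hrcN₁ rc₂ hrc₂ hrcN₂ x'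

end Organs

end L1Fold

end Summit.HodgeConjecture.HodgeConjecture.Cruxes.HLiu418.F0P6aDatumOfInputs

end
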